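import Summits.BirchSwinnertonDyer.BirchSwinnertonDyer.Theorems.AdditiveRankOneUnitTwistCertificateKernels
import Literature.NumberTheory.EllipticCurves.BSDSelmerPConverseSerreProofs
import HarnessLib

/-!
# The unit-twist certificate road in the BINDERS of K9 19200 `WildRankOne` / KT 19984 `TameRankOne`: per-row certificates
# (a unit-Ш_an odd Heegner twist; on non-tower rows also Coates–Sujatha (A) at that ONE twist) + the ♭-IMC equality ⟹ BSD_p

Prover seat `bsd-potss-kmc`, gen 21 (cell `bsd-potss`), 2026-08-27. Sequel of `AdditiveRankOneUnitTwistCertificateKernels.lean`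
(per-datum kernels §2–§4, K9 tower binder form §5). HONEST FRAMING: CONDITIONAL on every displayed hypothesis; 0 definitions,
0 named facts, 0 `sorry`; closes nothing; BSD_p for no curve. The certificate hypotheses `hCert` / `hCertA` are PER-ROW existence
statements (an explicit Heegner datum with `d_K` odd `< −4`, `L(E^{(d_K)},1) ≠ 0`, `ord_p #Ш_an(E^{(d_K)}) ≤ 0`, and for `hCertA`
the finite generation of the dual fine Selmer group of that one twist) — decided row by row by numerics / class-number criteria
(census job of this seat on item 19200), never class-wide theorems.

* §1 KT, `p ≥ 5`, `ρ̄_{E,p}` onto (tower by Serre's tree theorem): `bsdp_tameRankOne_surj_of_flatIMCEq_of_unitTwistCertificates_…`,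
  `missingPPartAt_…` — 19984's binders; NO L₀, NO (A).
* §2 K9, any irreducible row: `bsdp_wildRankOne_irreducible_of_flatIMCEq_of_unitTwistConjACertificates_…`, `missingPPartAt_…` —
  19200's binders; NO L₀; (A) only at the certified twists.
* §3 KT, any irreducible (t′) row: the same in 19984's binders.

References: [SerreAbelianLadic1968] Ch. IV §3.4 Lemma 3; [GrossZagier1986] I.(6.3), Thm. I.7.3; [JetchevSkinnerWan2017] §7.4.1;
[Kato2004Asterisque] Thm. 14.5 (3), Prop. 14.16 (2); [CoatesSujatha2005] §3; [Serre1967GroupesPDivisibles] §5 Prop. 8; [Miller2011LMS] Def. 1.1.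
-/

noncomputable section

open scoped Classical

set_option linter.dupNamespace false
set_option autoImplicit false

namespace Summit.BirchSwinnertonDyer.BirchSwinnertonDyer.Theorems.UniversalToricDescentWaldspurgerFlat

open WeierstrassCurve NumberField IsDedekindDomain Field PowerSeries
  Literature.NumberTheory.EllipticCurves
  Literature.NumberTheory.EllipticCurves.ModularForms
  Literature.NumberTheory.EllipticCurves.Rank1Residual
  Literature.NumberTheory.EllipticCurves.Rank1Residual.Typed
  Literature.NumberTheory.EllipticCurves.KrizLi2019
  Literature.NumberTheory.GaloisRepresentations
  Literature.NumberTheory.GaloisCohomology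
  Summit.BirchSwinnertonDyer.Rank1Residual
  Summit.BirchSwinnertonDyer.Rank1Residual.Additive
  Summit.BirchSwinnertonDyer.Rank1Residual.X11b
  Summit.BirchSwinnertonDyer.Rank1Residual.X11b.AcSelmer
  Summit.BirchSwinnertonDyer.Rank1Residual.X11b.Halves
  Summit.BirchSwinnertonDyer.Rank1Residual.X11b.CongruenceLimit
  Summit.BirchSwinnertonDyer.BirchSwinnertonDyer.Theses.UniversalToricDescent
  Summit.BirchSwinnertonDyer.BirchSwinnertonDyer.Theorems.AdditivePotSupersingularControl

section TameSurj

variable (p : ℕ) [Fact p.Prime] (hp5 : 5 ≤ p) (R : WeierstrassCurve ℚ → Prop)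

include hp5

/-! ## §1 KT's 19984 on the SURJECTIVE rows at `p ≥ 5`: the IMC + per-row unit-twist certificates (no L₀, no (A)) -/

/-- **KT's `TameRankOne` on the SURJECTIVE rows at `p ≥ 5` from the ♭-IMC equality and per-row UNIT-TWIST certificates (modulo
print)**, in 19984's binders `r_an = 1 → p ≠ 2 → Addv W p → SubTprime W p` (+ `ρ̄_{E,p}` onto, row predicate `R`): `BSDp W p` ⟸ `hEq`
(RESEARCH) ∧ `hCert` (for every class row an odd Heegner datum `d_K < −4` with `L(E^{(d_K)},1) ≠ 0` and a globally minimal model of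
`E^{(d_K)}` with `p`-unit analytic Ш — numeric, per row) ∧ A161″ ∧ the seven cohomological facts ∧ Hsieh ∧ LZZ ∧ ToricPublishedInputs.
Tower by Serre (tree theorem). CONDITIONAL; closes nothing; BSD_p for no curve. [cite: SerreAbelianLadic1968, Ch. IV §3.4, Lemma 3]
[cite: JetchevSkinnerWan2017, §7.4.1 and Thm. 3.3.1 (arXiv:1512.06894)] [cite: Kato2004Asterisque, Thm. 14.5 (3), Prop. 14.16 (2)]
[cite: Serre1967GroupesPDivisibles, §5 Prop. 8] -/
theorem bsdp_tameRankOne_surj_of_flatIMCEq_of_unitTwistCertificates_of_katoTam_of_facts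
    (hA : Hsieh2014.thmA_exists_isHsiehLFunction_unrPeriod_anyLevel)
    (hL : LiuZhangZhang2018.thm151_thm153_modularCurve_heegnerVector_additive)
    (hF : ToricPublishedInputs)
    (hKatoT : Kato2004.rankZero_padicValNat_sha_add_padicValNat_tamagawa_le_of_additive_potGood_of_imageContainsSL2)
    (hPT : ∀ (K : Type) [Field K] [NumberField K], poitouTate_selmerStructure_duality K)
    (hPT2 : ∀ (K : Type) [Field K] [NumberField K], poitouTate_sha_tateDual K)
    (hEP : ∀ (K : Type) [Field K] [NumberField K] (v : HeightOneSpectrum (𝓞 K)),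
      localEulerPoincareCharacteristic (v.adicCompletion K))
    (hcd : fieldCdLE_two_of_numberField)
    (hBr : ∀ (K : Type) [Field K] [NumberField K] (p : ℕ) [Fact p.Prime],
      ZpExtension.decomp_not_le_kerSubgroup_of_isAnticyclotomic K p)
    (hBr2 : ∀ (K : Type) [Field K] [NumberField K] (p : ℕ) [Fact p.Prime],
      ZpExtension.decomp_not_le_kerSubgroup_above_of_isAnticyclotomic K p)
    (hS : Serre1967.noStableDivisibleLine_of_potentiallySupersingular)
    (hEq : ∀ (W : WeierstrassCurve ℚ) [W.IsElliptic] [W.IsGloballyMinimal] (N : ℕ) [NeZero N] (K : Type) [Field K]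
      [NumberField K] (Dt : ModularParametrizationData W N),
      R W → Addv W p → SubTprime W p → W.HasSurjectiveModNGaloisRep p → W.analyticRank = 1 →
      W.conductorNorm ℤ = N → IsImaginaryQuadratic K → SatisfiesHeegnerHypothesis N K →
      ∀ (κ : ZpExtension K p), κ.IsAnticyclotomic → ∀ (γ : Field.absoluteGaloisGroup K) [Fact (κ.IsTopGenerator γ)]
        (𝔭 : HeightOneSpectrum (𝓞 K)), ((p : ℕ) : 𝓞 K) ∈ 𝔭.asIdeal → 𝔭.asIdeal.ramificationIdx (𝓞 ℚ) = 1 →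
        𝔭.asIdeal.inertiaDeg (𝓞 ℚ) = 1 → ∀ (𝔭' : HeightOneSpectrum (𝓞 K)), ((p : ℕ) : 𝓞 K) ∈ 𝔭'.asIdeal → 𝔭' ≠ 𝔭 →
        ∀ (ι' : PadicAlgCl p ≃+* ℂ), SchneiderFree.BranchInducesPrime p ι' 𝔭 →
        ∀ (ΩK : ℂ) (Ωp : ℂ_[p]) (Q : PowerSeries (PadicComplexInt p)), ΩK ≠ 0 → Ωp ≠ 0 →
          R1.IsBDPLFunctionInt p ι' 𝔭 κ γ Dt.f ΩK Ωp Q →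
          (XAc.charIdeal (W.baseChange K) p κ 𝔭' ∅ γ).map (PowerSeries.map (R1.toCpInt p)) = Ideal.span {Q})
    (hCert : ∀ (W : WeierstrassCurve ℚ) [W.IsElliptic] [W.IsGloballyMinimal],
      R W → Addv W p → SubTprime W p → W.HasSurjectiveModNGaloisRep p → W.analyticRank = 1 →
      ∃ (N : ℕ) (_ : NeZero N) (K : Type) (_ : Field K) (_ : NumberField K) (Dt : ModularParametrizationData W N)
        (H : HeegnerDatum N (NumberField.discr K)) (ι : K →+* ℂ) (P : (W.baseChange K).toAffine.Point)
        (Wd : WeierstrassCurve ℚ) (_ : Wd.IsElliptic) (_ : Wd.IsGloballyMinimal),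
        W.conductorNorm ℤ = N ∧ IsImaginaryQuadratic K ∧ SatisfiesHeegnerHypothesis N K ∧ Odd (NumberField.discr K) ∧
        NumberField.discr K < -4 ∧ (W.quadraticTwist (NumberField.discr K : ℚ)).entireLFunction 1 ≠ 0 ∧
        WeierstrassCurve.Affine.Point.map ι.toRatAlgHom P = heegnerPointComplex Dt H ∧
        (∃ C : VariableChange ℚ, C • W.quadraticTwist (NumberField.discr K : ℚ) = Wd) ∧
        (∃ qd : ℚ, shaAn Wd = (qd : ℂ) ∧ padicValRat p qd ≤ 0)) :
    ∀ (W : WeierstrassCurve ℚ) [W.IsElliptic] [W.IsGloballyMinimal], W.analyticRank = 1 → p ≠ 2 → Addv W p →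
      SubTprime W p → W.HasSurjectiveModNGaloisRep p → R W → BSDp W p := by
  intro W _ _ hr hp2 hadd hT hsurj hR
  have hO5 : ClassO5 W p := ⟨hp2, hadd, Or.inr hT⟩
  have htower : ∀ n : ℕ, W.HasSurjectiveModNGaloisRep (p ^ n : ℕ) :=
    serre_hasSurjectiveModNGaloisRep_pow_holds W p hp5 hsurj
  obtain ⟨N, _, K, _, _, Dt, H, ι, P, Wd, _, _, hN, hK, hHN, hodd, hd4, hLt, hP, hC, hunit⟩ := hCert W hR hadd hT hsurj hr
  exact bsdp_potSS_towerSurj_at_unitTwistDatum_of_flatIMCEq_of_katoTam_of_facts p hp2 hA hL hF hKatoT hPT hPT2 hEP hcd hBr hBr2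
    hS W (Or.inl hO5) htower hr Dt H ι P Wd hN hK hHN hodd hd4 hLt hP hC hunit
    (fun κ hκ γ _ 𝔭 h𝔭 he hf 𝔭' h𝔭' hne ι' hind ΩK Ωp Q hΩK hΩp hBDP ↦
      hEq W N K Dt hR hadd hT hsurj hr hN hK hHN κ hκ γ 𝔭 h𝔭 he hf 𝔭' h𝔭' hne ι' hind ΩK Ωp Q hΩK hΩp hBDP)

/-- **The same in 19984's currency `MissingPPartAt W p`** (`Ш(E/ℚ)` finite by GZK). CONDITIONAL; closes nothing.
[cite: SerreAbelianLadic1968, Ch. IV §3.4, Lemma 3] [cite: JetchevSkinnerWan2017, §7.4.1 (arXiv:1512.06894 p. 30)] -/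
theorem missingPPartAt_tameRankOne_surj_of_flatIMCEq_of_unitTwistCertificates_of_katoTam_of_facts
    (hA : Hsieh2014.thmA_exists_isHsiehLFunction_unrPeriod_anyLevel)
    (hL : LiuZhangZhang2018.thm151_thm153_modularCurve_heegnerVector_additive)
    (hF : ToricPublishedInputs)
    (hKatoT : Kato2004.rankZero_padicValNat_sha_add_padicValNat_tamagawa_le_of_additive_potGood_of_imageContainsSL2)
    (hPT : ∀ (K : Type) [Field K] [NumberField K], poitouTate_selmerStructure_duality K)
    (hPT2 : ∀ (K : Type) [Field K] [NumberField K], poitouTate_sha_tateDual K)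
    (hEP : ∀ (K : Type) [Field K] [NumberField K] (v : HeightOneSpectrum (𝓞 K)),
      localEulerPoincareCharacteristic (v.adicCompletion K))
    (hcd : fieldCdLE_two_of_numberField)
    (hBr : ∀ (K : Type) [Field K] [NumberField K] (p : ℕ) [Fact p.Prime],
      ZpExtension.decomp_not_le_kerSubgroup_of_isAnticyclotomic K p)
    (hBr2 : ∀ (K : Type) [Field K] [NumberField K] (p : ℕ) [Fact p.Prime],
      ZpExtension.decomp_not_le_kerSubgroup_above_of_isAnticyclotomic K p)
    (hS : Serre1967.noStableDivisibleLine_of_potentiallySupersingular)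
    (hEq : ∀ (W : WeierstrassCurve ℚ) [W.IsElliptic] [W.IsGloballyMinimal] (N : ℕ) [NeZero N] (K : Type) [Field K]
      [NumberField K] (Dt : ModularParametrizationData W N),
      R W → Addv W p → SubTprime W p → W.HasSurjectiveModNGaloisRep p → W.analyticRank = 1 →
      W.conductorNorm ℤ = N → IsImaginaryQuadratic K → SatisfiesHeegnerHypothesis N K →
      ∀ (κ : ZpExtension K p), κ.IsAnticyclotomic → ∀ (γ : Field.absoluteGaloisGroup K) [Fact (κ.IsTopGenerator γ)]
        (𝔭 : HeightOneSpectrum (𝓞 K)), ((p : ℕ) : 𝓞 K) ∈ 𝔭.asIdeal → 𝔭.asIdeal.ramificationIdx (𝓞 ℚ) = 1 →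
        𝔭.asIdeal.inertiaDeg (𝓞 ℚ) = 1 → ∀ (𝔭' : HeightOneSpectrum (𝓞 K)), ((p : ℕ) : 𝓞 K) ∈ 𝔭'.asIdeal → 𝔭' ≠ 𝔭 →
        ∀ (ι' : PadicAlgCl p ≃+* ℂ), SchneiderFree.BranchInducesPrime p ι' 𝔭 →
        ∀ (ΩK : ℂ) (Ωp : ℂ_[p]) (Q : PowerSeries (PadicComplexInt p)), ΩK ≠ 0 → Ωp ≠ 0 →
          R1.IsBDPLFunctionInt p ι' 𝔭 κ γ Dt.f ΩK Ωp Q →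
          (XAc.charIdeal (W.baseChange K) p κ 𝔭' ∅ γ).map (PowerSeries.map (R1.toCpInt p)) = Ideal.span {Q})
    (hCert : ∀ (W : WeierstrassCurve ℚ) [W.IsElliptic] [W.IsGloballyMinimal],
      R W → Addv W p → SubTprime W p → W.HasSurjectiveModNGaloisRep p → W.analyticRank = 1 →
      ∃ (N : ℕ) (_ : NeZero N) (K : Type) (_ : Field K) (_ : NumberField K) (Dt : ModularParametrizationData W N)
        (H : HeegnerDatum N (NumberField.discr K)) (ι : K →+* ℂ) (P : (W.baseChange K).toAffine.Point)
        (Wd : WeierstrassCurve ℚ) (_ : Wd.IsElliptic) (_ : Wd.IsGloballyMinimal),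
        W.conductorNorm ℤ = N ∧ IsImaginaryQuadratic K ∧ SatisfiesHeegnerHypothesis N K ∧ Odd (NumberField.discr K) ∧
        NumberField.discr K < -4 ∧ (W.quadraticTwist (NumberField.discr K : ℚ)).entireLFunction 1 ≠ 0 ∧
        WeierstrassCurve.Affine.Point.map ι.toRatAlgHom P = heegnerPointComplex Dt H ∧
        (∃ C : VariableChange ℚ, C • W.quadraticTwist (NumberField.discr K : ℚ) = Wd) ∧
        (∃ qd : ℚ, shaAn Wd = (qd : ℂ) ∧ padicValRat p qd ≤ 0)) :
    ∀ (W : WeierstrassCurve ℚ) [W.IsElliptic] [W.IsGloballyMinimal], W.analyticRank = 1 → p ≠ 2 → Addv W p →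
      SubTprime W p → W.HasSurjectiveModNGaloisRep p → R W → MissingPPartAt W p := by
  intro W _ _ hr hp2 hadd hT hsurj hR
  have hGZK : rank_eq_analyticRank_of_analyticRank_le_one := hF.2.2.1
  haveI : Finite W.sha := (hGZK W (by omega)).2
  exact missingPPartAt_of_bsdp W p
    (bsdp_tameRankOne_surj_of_flatIMCEq_of_unitTwistCertificates_of_katoTam_of_facts p hp5 R hA hL hF hKatoT hPT hPT2 hEP hcd hBr
      hBr2 hS hEq hCert W hr hp2 hadd hT hsurj hR)

end TameSurj

section WildThree

variable [Fact (3 : ℕ).Prime] (R : WeierstrassCurve ℚ → Prop)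

/-! ## §2 K9's 19200 on ALL irreducible rows: the IMC + per-row certificates {unit twist, (A) at that twist} (no L₀) -/

/-- **K9's `WildRankOne` on ALL irreducible rows from the ♭-IMC equality and per-row certificates (modulo print)**: on `r_an = 1`,
`ClassO6 W 3`, `ρ̄_{E,3}` irreducible, `R W`: `BSDp W 3` ⟸ `hEq` (RESEARCH) ∧ `hCertA` (for every class row an odd Heegner datum
`d_K < −4` with `L(E^{(d_K)},1) ≠ 0`, a globally minimal model `Wd` of `E^{(d_K)}` with `3`-unit analytic Ш, AND Coates–Sujatha (A) at
`(Wd, 3)` — both decided per row) ∧ Kato's fine reading ∧ the seven cohomological facts ∧ Hsieh ∧ LZZ ∧ ToricPublishedInputs. NO L₀, no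
class-wide (A), no tower hypothesis. CONDITIONAL; closes nothing; BSD₃ for no curve.
[cite: JetchevSkinnerWan2017, §7.4.1 and Thm. 3.3.1 (arXiv:1512.06894)] [cite: Kato2004Asterisque, Thm. 14.5 (3), Prop. 14.16 (2)]
[cite: CoatesSujatha2005, §3 (Conjecture A)] [cite: Serre1967GroupesPDivisibles, §5 Prop. 8] -/
theorem bsdp_wildRankOne_irreducible_of_flatIMCEq_of_unitTwistConjACertificates_of_kato_of_facts
    (hA : Hsieh2014.thmA_exists_isHsiehLFunction_unrPeriod_anyLevel)
    (hL : LiuZhangZhang2018.thm151_thm153_modularCurve_heegnerVector_additive)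
    (hF : ToricPublishedInputs)
    (hKatoA :
      Kato2004.rankZero_padicValNat_sha_add_padicValNat_tamagawa_le_of_additive_potGood_of_irreducible_of_fineSelmerDual_fg)
    (hPT : ∀ (K : Type) [Field K] [NumberField K], poitouTate_selmerStructure_duality K)
    (hPT2 : ∀ (K : Type) [Field K] [NumberField K], poitouTate_sha_tateDual K)
    (hEP : ∀ (K : Type) [Field K] [NumberField K] (v : HeightOneSpectrum (𝓞 K)),
      localEulerPoincareCharacteristic (v.adicCompletion K))
    (hcd : fieldCdLE_two_of_numberField)
    (hBr : ∀ (K : Type) [Field K] [NumberField K] (p : ℕ) [Fact p.Prime],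
      ZpExtension.decomp_not_le_kerSubgroup_of_isAnticyclotomic K p)
    (hBr2 : ∀ (K : Type) [Field K] [NumberField K] (p : ℕ) [Fact p.Prime],
      ZpExtension.decomp_not_le_kerSubgroup_above_of_isAnticyclotomic K p)
    (hS : Serre1967.noStableDivisibleLine_of_potentiallySupersingular)
    (hEq : ∀ (W : WeierstrassCurve ℚ) [W.IsElliptic] [W.IsGloballyMinimal] (N : ℕ) [NeZero N] (K : Type) [Field K]
      [NumberField K] (Dt : ModularParametrizationData W N),
      R W → ClassO6 W 3 → W.HasIrreducibleModPGaloisRep 3 → W.analyticRank = 1 →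
      W.conductorNorm ℤ = N → IsImaginaryQuadratic K → SatisfiesHeegnerHypothesis N K →
      ∀ (κ : ZpExtension K 3), κ.IsAnticyclotomic → ∀ (γ : Field.absoluteGaloisGroup K) [Fact (κ.IsTopGenerator γ)]
        (𝔭 : HeightOneSpectrum (𝓞 K)), ((3 : ℕ) : 𝓞 K) ∈ 𝔭.asIdeal → 𝔭.asIdeal.ramificationIdx (𝓞 ℚ) = 1 →
        𝔭.asIdeal.inertiaDeg (𝓞 ℚ) = 1 → ∀ (𝔭' : HeightOneSpectrum (𝓞 K)), ((3 : ℕ) : 𝓞 K) ∈ 𝔭'.asIdeal → 𝔭' ≠ 𝔭 →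
        ∀ (ι' : PadicAlgCl 3 ≃+* ℂ), SchneiderFree.BranchInducesPrime 3 ι' 𝔭 →
        ∀ (ΩK : ℂ) (Ωp : ℂ_[3]) (Q : PowerSeries (PadicComplexInt 3)), ΩK ≠ 0 → Ωp ≠ 0 →
          R1.IsBDPLFunctionInt 3 ι' 𝔭 κ γ Dt.f ΩK Ωp Q →
          (XAc.charIdeal (W.baseChange K) 3 κ 𝔭' ∅ γ).map (PowerSeries.map (R1.toCpInt 3)) = Ideal.span {Q})
    (hCertA : ∀ (W : WeierstrassCurve ℚ) [W.IsElliptic] [W.IsGloballyMinimal],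
      R W → ClassO6 W 3 → W.HasIrreducibleModPGaloisRep 3 → W.analyticRank = 1 →
      ∃ (N : ℕ) (_ : NeZero N) (K : Type) (_ : Field K) (_ : NumberField K) (Dt : ModularParametrizationData W N)
        (H : HeegnerDatum N (NumberField.discr K)) (ι : K →+* ℂ) (P : (W.baseChange K).toAffine.Point)
        (Wd : WeierstrassCurve ℚ) (_ : Wd.IsElliptic) (_ : Wd.IsGloballyMinimal),
        W.conductorNorm ℤ = N ∧ IsImaginaryQuadratic K ∧ SatisfiesHeegnerHypothesis N K ∧ Odd (NumberField.discr K) ∧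
        NumberField.discr K < -4 ∧ (W.quadraticTwist (NumberField.discr K : ℚ)).entireLFunction 1 ≠ 0 ∧
        WeierstrassCurve.Affine.Point.map ι.toRatAlgHom P = heegnerPointComplex Dt H ∧
        (∃ C : VariableChange ℚ, C • W.quadraticTwist (NumberField.discr K : ℚ) = Wd) ∧
        (∃ qd : ℚ, shaAn Wd = (qd : ℂ) ∧ padicValRat 3 qd ≤ 0) ∧
        (∀ (κ : ZpExtension ℚ 3), κ.IsCyclotomic → ∃ (γ : Field.absoluteGaloisGroup ℚ) (D : Wd.FineSelmerDualData κ γ),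
          Module.Finite ℤ_[3] (RestrictScalars ℤ_[3] (IwasawaAlgebra 3) D.X))) :
    ∀ (W : WeierstrassCurve ℚ) [W.IsElliptic] [W.IsGloballyMinimal], W.analyticRank = 1 → ClassO6 W 3 →
      W.HasIrreducibleModPGaloisRep 3 → R W → BSDp W 3 := by
  intro W _ _ hr hO6 hirr hR
  obtain ⟨N, _, K, _, _, Dt, H, ι, P, Wd, _, _, hN, hK, hHN, hodd, hd4, hLt, hP, hC, hunit, hAd⟩ := hCertA W hR hO6 hirr hr
  exact bsdp_potSS_at_unitTwistDatum_of_flatIMCEq_of_fineSelmerDual_fg_of_facts 3 (by decide) hA hL hF hKatoA hPT hPT2 hEP hcd hBr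
    hBr2 hS W (Or.inr hO6) hirr hr Dt H ι P Wd hN hK hHN hodd hd4 hLt hP hC hunit hAd
    (fun κ hκ γ _ 𝔭 h𝔭 he hf 𝔭' h𝔭' hne ι' hind ΩK Ωp Q hΩK hΩp hBDP ↦
      hEq W N K Dt hR hO6 hirr hr hN hK hHN κ hκ γ 𝔭 h𝔭 he hf 𝔭' h𝔭' hne ι' hind ΩK Ωp Q hΩK hΩp hBDP)

/-- **The same in 19200's currency `MissingPPartAt W 3`** (`Ш(E/ℚ)` finite by GZK). CONDITIONAL; closes nothing.
[cite: JetchevSkinnerWan2017, §7.4.1 (arXiv:1512.06894 p. 30)] [cite: CoatesSujatha2005, §3 (Conjecture A)] -/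
theorem missingPPartAt_wildRankOne_irreducible_of_flatIMCEq_of_unitTwistConjACertificates_of_kato_of_facts
    (hA : Hsieh2014.thmA_exists_isHsiehLFunction_unrPeriod_anyLevel)
    (hL : LiuZhangZhang2018.thm151_thm153_modularCurve_heegnerVector_additive)
    (hF : ToricPublishedInputs)
    (hKatoA :
      Kato2004.rankZero_padicValNat_sha_add_padicValNat_tamagawa_le_of_additive_potGood_of_irreducible_of_fineSelmerDual_fg)
    (hPT : ∀ (K : Type) [Field K] [NumberField K], poitouTate_selmerStructure_duality K)
    (hPT2 : ∀ (K : Type) [Field K] [NumberField K], poitouTate_sha_tateDual K)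
    (hEP : ∀ (K : Type) [Field K] [NumberField K] (v : HeightOneSpectrum (𝓞 K)),
      localEulerPoincareCharacteristic (v.adicCompletion K))
    (hcd : fieldCdLE_two_of_numberField)
    (hBr : ∀ (K : Type) [Field K] [NumberField K] (p : ℕ) [Fact p.Prime],
      ZpExtension.decomp_not_le_kerSubgroup_of_isAnticyclotomic K p)
    (hBr2 : ∀ (K : Type) [Field K] [NumberField K] (p : ℕ) [Fact p.Prime],
      ZpExtension.decomp_not_le_kerSubgroup_above_of_isAnticyclotomic K p)
    (hS : Serre1967.noStableDivisibleLine_of_potentiallySupersingular)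
    (hEq : ∀ (W : WeierstrassCurve ℚ) [W.IsElliptic] [W.IsGloballyMinimal] (N : ℕ) [NeZero N] (K : Type) [Field K]
      [NumberField K] (Dt : ModularParametrizationData W N),
      R W → ClassO6 W 3 → W.HasIrreducibleModPGaloisRep 3 → W.analyticRank = 1 →
      W.conductorNorm ℤ = N → IsImaginaryQuadratic K → SatisfiesHeegnerHypothesis N K →
      ∀ (κ : ZpExtension K 3), κ.IsAnticyclotomic → ∀ (γ : Field.absoluteGaloisGroup K) [Fact (κ.IsTopGenerator γ)]
        (𝔭 : HeightOneSpectrum (𝓞 K)), ((3 : ℕ) : 𝓞 K) ∈ 𝔭.asIdeal → 𝔭.asIdeal.ramificationIdx (𝓞 ℚ) = 1 →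
        𝔭.asIdeal.inertiaDeg (𝓞 ℚ) = 1 → ∀ (𝔭' : HeightOneSpectrum (𝓞 K)), ((3 : ℕ) : 𝓞 K) ∈ 𝔭'.asIdeal → 𝔭' ≠ 𝔭 →
        ∀ (ι' : PadicAlgCl 3 ≃+* ℂ), SchneiderFree.BranchInducesPrime 3 ι' 𝔭 →
        ∀ (ΩK : ℂ) (Ωp : ℂ_[3]) (Q : PowerSeries (PadicComplexInt 3)), ΩK ≠ 0 → Ωp ≠ 0 →
          R1.IsBDPLFunctionInt 3 ι' 𝔭 κ γ Dt.f ΩK Ωp Q →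
          (XAc.charIdeal (W.baseChange K) 3 κ 𝔭' ∅ γ).map (PowerSeries.map (R1.toCpInt 3)) = Ideal.span {Q})
    (hCertA : ∀ (W : WeierstrassCurve ℚ) [W.IsElliptic] [W.IsGloballyMinimal],
      R W → ClassO6 W 3 → W.HasIrreducibleModPGaloisRep 3 → W.analyticRank = 1 →
      ∃ (N : ℕ) (_ : NeZero N) (K : Type) (_ : Field K) (_ : NumberField K) (Dt : ModularParametrizationData W N)
        (H : HeegnerDatum N (NumberField.discr K)) (ι : K →+* ℂ) (P : (W.baseChange K).toAffine.Point)
        (Wd : WeierstrassCurve ℚ) (_ : Wd.IsElliptic) (_ : Wd.IsGloballyMinimal),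
        W.conductorNorm ℤ = N ∧ IsImaginaryQuadratic K ∧ SatisfiesHeegnerHypothesis N K ∧ Odd (NumberField.discr K) ∧
        NumberField.discr K < -4 ∧ (W.quadraticTwist (NumberField.discr K : ℚ)).entireLFunction 1 ≠ 0 ∧
        WeierstrassCurve.Affine.Point.map ι.toRatAlgHom P = heegnerPointComplex Dt H ∧
        (∃ C : VariableChange ℚ, C • W.quadraticTwist (NumberField.discr K : ℚ) = Wd) ∧
        (∃ qd : ℚ, shaAn Wd = (qd : ℂ) ∧ padicValRat 3 qd ≤ 0) ∧
        (∀ (κ : ZpExtension ℚ 3), κ.IsCyclotomic → ∃ (γ : Field.absoluteGaloisGroup ℚ) (D : Wd.FineSelmerDualData κ γ),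
          Module.Finite ℤ_[3] (RestrictScalars ℤ_[3] (IwasawaAlgebra 3) D.X))) :
    ∀ (W : WeierstrassCurve ℚ) [W.IsElliptic] [W.IsGloballyMinimal], W.analyticRank = 1 → ClassO6 W 3 →
      W.HasIrreducibleModPGaloisRep 3 → R W → MissingPPartAt W 3 := by
  intro W _ _ hr hO6 hirr hR
  have hGZK : rank_eq_analyticRank_of_analyticRank_le_one := hF.2.2.1
  haveI : Finite W.sha := (hGZK W (by omega)).2
  exact missingPPartAt_of_bsdp W 3
    (bsdp_wildRankOne_irreducible_of_flatIMCEq_of_unitTwistConjACertificates_of_kato_of_facts R hA hL hF hKatoA hPT hPT2 hEP hcd hBr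
      hBr2 hS hEq hCertA W hr hO6 hirr hR)

end WildThree

section TameIrr

variable (p : ℕ) [Fact p.Prime] (R : WeierstrassCurve ℚ → Prop)

/-! ## §3 KT's 19984 on ALL irreducible (t′) rows: the IMC + per-row certificates {unit twist, (A) at that twist} (no L₀) -/

/-- **KT's `TameRankOne` on ALL irreducible rows from the ♭-IMC equality and per-row certificates (modulo print)**, in 19984's
binders `r_an = 1 → p ≠ 2 → Addv W p → SubTprime W p` (+ `ρ̄_{E,p}` irreducible, row predicate `R`): `MissingPPartAt W p` ⟸ `hEq`
(RESEARCH) ∧ `hCertA` (unit-twist datum + (A) at the twist, per row) ∧ Kato's fine reading ∧ the seven cohomological facts ∧ Hsieh ∧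
LZZ ∧ ToricPublishedInputs. CONDITIONAL; closes nothing; BSD_p for no curve.
[cite: JetchevSkinnerWan2017, §7.4.1 and Thm. 3.3.1 (arXiv:1512.06894)] [cite: Kato2004Asterisque, Thm. 14.5 (3), Prop. 14.16 (2)]
[cite: CoatesSujatha2005, §3 (Conjecture A)] [cite: Serre1967GroupesPDivisibles, §5 Prop. 8] -/
theorem missingPPartAt_tameRankOne_irreducible_of_flatIMCEq_of_unitTwistConjACertificates_of_kato_of_facts
    (hA : Hsieh2014.thmA_exists_isHsiehLFunction_unrPeriod_anyLevel)
    (hL : LiuZhangZhang2018.thm151_thm153_modularCurve_heegnerVector_additive)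
    (hF : ToricPublishedInputs)
    (hKatoA :
      Kato2004.rankZero_padicValNat_sha_add_padicValNat_tamagawa_le_of_additive_potGood_of_irreducible_of_fineSelmerDual_fg)
    (hPT : ∀ (K : Type) [Field K] [NumberField K], poitouTate_selmerStructure_duality K)
    (hPT2 : ∀ (K : Type) [Field K] [NumberField K], poitouTate_sha_tateDual K)
    (hEP : ∀ (K : Type) [Field K] [NumberField K] (v : HeightOneSpectrum (𝓞 K)),
      localEulerPoincareCharacteristic (v.adicCompletion K))
    (hcd : fieldCdLE_two_of_numberField)
    (hBr : ∀ (K : Type) [Field K] [NumberField K] (p : ℕ) [Fact p.Prime],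
      ZpExtension.decomp_not_le_kerSubgroup_of_isAnticyclotomic K p)
    (hBr2 : ∀ (K : Type) [Field K] [NumberField K] (p : ℕ) [Fact p.Prime],
      ZpExtension.decomp_not_le_kerSubgroup_above_of_isAnticyclotomic K p)
    (hS : Serre1967.noStableDivisibleLine_of_potentiallySupersingular)
    (hEq : ∀ (W : WeierstrassCurve ℚ) [W.IsElliptic] [W.IsGloballyMinimal] (N : ℕ) [NeZero N] (K : Type) [Field K]
      [NumberField K] (Dt : ModularParametrizationData W N),
      R W → Addv W p → SubTprime W p → W.HasIrreducibleModPGaloisRep p → W.analyticRank = 1 →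
      W.conductorNorm ℤ = N → IsImaginaryQuadratic K → SatisfiesHeegnerHypothesis N K →
      ∀ (κ : ZpExtension K p), κ.IsAnticyclotomic → ∀ (γ : Field.absoluteGaloisGroup K) [Fact (κ.IsTopGenerator γ)]
        (𝔭 : HeightOneSpectrum (𝓞 K)), ((p : ℕ) : 𝓞 K) ∈ 𝔭.asIdeal → 𝔭.asIdeal.ramificationIdx (𝓞 ℚ) = 1 →
        𝔭.asIdeal.inertiaDeg (𝓞 ℚ) = 1 → ∀ (𝔭' : HeightOneSpectrum (𝓞 K)), ((p : ℕ) : 𝓞 K) ∈ 𝔭'.asIdeal → 𝔭' ≠ 𝔭 →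
        ∀ (ι' : PadicAlgCl p ≃+* ℂ), SchneiderFree.BranchInducesPrime p ι' 𝔭 →
        ∀ (ΩK : ℂ) (Ωp : ℂ_[p]) (Q : PowerSeries (PadicComplexInt p)), ΩK ≠ 0 → Ωp ≠ 0 →
          R1.IsBDPLFunctionInt p ι' 𝔭 κ γ Dt.f ΩK Ωp Q →
          (XAc.charIdeal (W.baseChange K) p κ 𝔭' ∅ γ).map (PowerSeries.map (R1.toCpInt p)) = Ideal.span {Q})
    (hCertA : ∀ (W : WeierstrassCurve ℚ) [W.IsElliptic] [W.IsGloballyMinimal],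
      R W → Addv W p → SubTprime W p → W.HasIrreducibleModPGaloisRep p → W.analyticRank = 1 →
      ∃ (N : ℕ) (_ : NeZero N) (K : Type) (_ : Field K) (_ : NumberField K) (Dt : ModularParametrizationData W N)
        (H : HeegnerDatum N (NumberField.discr K)) (ι : K →+* ℂ) (P : (W.baseChange K).toAffine.Point)
        (Wd : WeierstrassCurve ℚ) (_ : Wd.IsElliptic) (_ : Wd.IsGloballyMinimal),
        W.conductorNorm ℤ = N ∧ IsImaginaryQuadratic K ∧ SatisfiesHeegnerHypothesis N K ∧ Odd (NumberField.discr K) ∧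
        NumberField.discr K < -4 ∧ (W.quadraticTwist (NumberField.discr K : ℚ)).entireLFunction 1 ≠ 0 ∧
        WeierstrassCurve.Affine.Point.map ι.toRatAlgHom P = heegnerPointComplex Dt H ∧
        (∃ C : VariableChange ℚ, C • W.quadraticTwist (NumberField.discr K : ℚ) = Wd) ∧
        (∃ qd : ℚ, shaAn Wd = (qd : ℂ) ∧ padicValRat p qd ≤ 0) ∧
        (∀ (κ : ZpExtension ℚ p), κ.IsCyclotomic → ∃ (γ : Field.absoluteGaloisGroup ℚ) (D : Wd.FineSelmerDualData κ γ),
          Module.Finite ℤ_[p] (RestrictScalars ℤ_[p] (IwasawaAlgebra p) D.X))) :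
    ∀ (W : WeierstrassCurve ℚ) [W.IsElliptic] [W.IsGloballyMinimal], W.analyticRank = 1 → p ≠ 2 → Addv W p →
      SubTprime W p → W.HasIrreducibleModPGaloisRep p → R W → MissingPPartAt W p := by
  intro W _ _ hr hp2 hadd hT hirr hR
  have hO5 : ClassO5 W p := ⟨hp2, hadd, Or.inr hT⟩
  have hGZK : rank_eq_analyticRank_of_analyticRank_le_one := hF.2.2.1
  haveI : Finite W.sha := (hGZK W (by omega)).2
  obtain ⟨N, _, K, _, _, Dt, H, ι, P, Wd, _, _, hN, hK, hHN, hodd, hd4, hLt, hP, hC, hunit, hAd⟩ :=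
    hCertA W hR hadd hT hirr hr
  exact missingPPartAt_of_bsdp W p
    (bsdp_potSS_at_unitTwistDatum_of_flatIMCEq_of_fineSelmerDual_fg_of_facts p hp2 hA hL hF hKatoA hPT hPT2 hEP hcd hBr hBr2 hS W
      (Or.inl hO5) hirr hr Dt H ι P Wd hN hK hHN hodd hd4 hLt hP hC hunit hAd
      (fun κ hκ γ _ 𝔭 h𝔭 he hf 𝔭' h𝔭' hne ι' hind ΩK Ωp Q hΩK hΩp hBDP ↦
        hEq W N K Dt hR hadd hT hirr hr hN hK hHN κ hκ γ 𝔭 h𝔭 he hf 𝔭' h𝔭' hne ι' hind ΩK Ωp Q hΩK hΩp hBDP))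

end TameIrr

end Summit.BirchSwinnertonDyer.BirchSwinnertonDyer.Theorems.UniversalToricDescentWaldspurgerFlat

end
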